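import Mathlib

/-!
# Tensor trains: site-by-site contraction (TT quadrature), the quantics representation, and the
# classical exact low-rank quantics tensor trains

A TENSOR TRAIN (TT, matrix product state) with `L` legs, each indexed by `σ`, and bond
dimensions `r_0, …, r_L` represents the tensor
`T(s_0, …, s_{L-1}) = l · M_0^{s_0} M_1^{s_1} ⋯ M_{L-1}^{s_{L-1}} · r`, where `M_ℓ^{a}` is an
`r_ℓ × r_{ℓ+1}` matrix (the CORE of site `ℓ` at leg value `a`) and `l ∈ K^{r_0}`, `r ∈ K^{r_L}`
are boundary vectors (the usual convention is `r_0 = r_L = 1`, `l = r = 1`)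
[GolubVanLoan2013, §12.5.8 (12.5.25); NunezFernandezEtAl2025, §4.1; Khoromskij2015, §1.5].
Two facts make the format the work-horse of high-dimensional quadrature
[NunezFernandezEtAl2025, §§5–6; Khoromskij2015, §1.3]:

* SITE-BY-SITE CONTRACTION.  A sum of `T` against PRODUCT WEIGHTS — e.g. a product quadrature
  rule `∫ f ≈ Σ_σ (Π_ℓ w_{σ_ℓ}) F̃_σ` applied to a tensor train `F̃ ≈ f` obtained by tensor cross
  interpolation — factorises, `Σ_s (Π_ℓ W_ℓ(s_ℓ)) T(s) = l · (Σ_a W_0(a) M_0^a) ⋯ (Σ_a W_{L-1}(a)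
  M_{L-1}^a) · r`: `L · |σ|` core operations instead of `|σ|^L` terms [NunezFernandezEtAl2025,
  §5.1; Khoromskij2015, §1.3 (quadrature as a scalar product of QTT tensors)].
* THE QUANTICS REPRESENTATION.  A function of one variable on a grid of `b^R` points
  `x = m / b^R` becomes an `R`-leg tensor by writing the grid index in base `b`,
  `m(σ) = Σ_r σ_r b^{R-1-r}` (most significant digit first, digit `r` resolving the scale
  `b^{-(r+1)}`); several variables are laid out INTERLEAVED (site `n + N r` carries digit `r` of
  variable `n`), FUSED (site `r` carries the digits `r` of all variables) or variable by variable
  [NunezFernandezEtAl2025, §6.1].  Elementary functions have EXACT quantics tensor trains of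
  small rank uniformly in the grid size: exponentials rank 1, sine/cosine rank 2, polynomials of
  degree `p` rank `≤ p + 1`, the Kronecker delta rank 1, the step function rank 2
  [Khoromskij2015, §1.2 and §1.3, Lem. 1.4, Ex. 1.5; NunezFernandezEtAl2025, §6.1]; and the format
  is closed under sums (block-diagonal cores, ranks add) and entrywise products (Kronecker cores,
  ranks multiply) [NunezFernandezEtAl2025, §4.7; Khoromskij2015, §1.5].

This file formalises these statements exactly (no approximation), over a commutative semiring
unless stated otherwise; sites are numbered `0, …, L-1`, configurations are `s : Fin L → σ`:

* `TensorTrain K σ L` — bond dimensions `r : ℕ → ℕ`, cores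
  `core ℓ a : Matrix (Fin (r ℓ)) (Fin (r (ℓ+1))) K`, boundary vectors `lbdry`, `rbdry`;
  `leftProd k s = M_0^{s_0} ⋯ M_{k-1}^{s_{k-1}}`, `segProd k m t` (the product of the `m` cores
  from site `k` on), `eval s = lbdry ⬝ (leftProd L s) rbdry`; `eval_eq_entry` (the
  `r_0 = r_L = 1` convention) [GolubVanLoan2013, §12.5.8];
* `leftProd_split`, `eval_append_eq_sum_bond` — across every bond the value is a sum of `r_k`
  products (left factor × right factor); `rank_unfolding_le` — hence (over a field) the `k`-th
  UNFOLDING MATRIX `(s, t) ↦ T(s ⊕ t)` has rank `≤ r_k` [Khoromskij2015, §1.5 (`TT[r]` is the set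
  of tensors with unfolding ranks `≤ r_p`); GolubVanLoan2013, §12.5.8];
* `sumProd`, `sum_prod_smul_leftProd`, `sum_prod_mul_eval`, `sum_eval` — TT QUADRATURE: the sum
  against product weights is the boundary contraction of the product of the weighted site sums
  [NunezFernandezEtAl2025, §5.1; Khoromskij2015, §1.3];
* `quanticsEquiv b R : (Fin R → Fin b) ≃ Fin (b^R)` (most significant digit first),
  `val_quanticsEquiv` (`m(σ) = Σ_r σ_r b^{R-1-r}`), `quanticsEquiv_symm_apply_val` (the digits of
  `m`), `cast_quanticsEquiv_div_pow` (the grid point `m/b^R = Σ_r σ_r b^{-(r+1)}`),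
  `val_quanticsEquiv_snoc` (`m(σ a) = b m(σ) + a`), `sum_comp_quanticsEquiv`; the layouts
  `interleavedEquiv`, `fusedEquiv`, `serialEquiv` with their site formulas
  `interleaved_site_val` (`n + N r`), `fused_site_val` (`σ̃_r = Σ_n σ_{n r} b^n`),
  `serial_site_val` (`r + R n`) and `sum_comp_*Equiv` (a grid sum is a sum over site
  configurations) [NunezFernandezEtAl2025, §6.1];
* `TensorTrain.uniform`, `chainProd`, `apply_add_sum_eq_vecMul_chainProd`,
  `eval_uniform_of_shift` — the TRANSFER-MATRIX MECHANISM: a shift-invariant family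
  `u(x + a) = u(x) · M(a)` of `n` functions sampled on any grid whose points are sums of site
  contributions `x(s) = x₀ + Σ_ℓ t_ℓ(s_ℓ)` (the quantics grid, its affine images such as cell
  midpoints, in any layout) spans tensor trains of bond dimension `n` with cores `M(t_ℓ(a))`
  [Khoromskij2015, §1.3]; instances: `pow_sum_eq_prod_pow`, `eval_uniform_pow`,
  `real_exp_affine_sum_eq_prod` (exponentials, rank 1) [Khoromskij2015, Lem. 1.4;
  NunezFernandezEtAl2025, §6.1]; `rotCore`, `cosSin_add_eq_vecMul_rotCore`,
  `eval_uniform_rotCore` (`c₀ cos ωx + c₁ sin ωx`, rank 2, rotation cores) [Khoromskij2015, §1.3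
  and Ex. 1.5; NunezFernandezEtAl2025, §6.1]; `binomShift`, `pow_add_eq_vecMul_binomShift`,
  `eval_uniform_binomShift` (a polynomial of degree `≤ p`, rank `≤ p + 1`, binomial cores)
  [Khoromskij2015, §1.2];
* `quantics_delta_eq_prod` (`δ_{m(σ) m(μ)} = Π_r δ_{σ_r μ_r}`, rank 1 in the fused pair
  representation), `stepCore`, `vecMul_chainProd_stepCore`, `eval_uniform_stepCore` (the
  comparison automaton: `c₀ 𝟙[m₁ = m₂] + c₁ 𝟙[m₁ < m₂]`, in particular the step `θ(m₂ - m₁)`,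
  rank 2) [NunezFernandezEtAl2025, §6.1];
* `TensorTrain.add`, `leftProd_add`, `eval_add` (block-diagonal cores represent the sum)
  [NunezFernandezEtAl2025, §4.7]; `TensorTrain.hadamard`, `leftProd_hadamard`, `eval_hadamard`
  (Kronecker cores represent the entrywise product; with `sum_eval`, `⟨X, Y⟩ = ⟨X ⊙ Y, 1⟩`)
  [Khoromskij2015, §1.5].

Not formalised: anything approximate or algorithmic — ε-ranks and SVD/CI truncation, the TT-SVD
and cross algorithms, quadrature ERROR (the statements here are exact identities for the discrete
sums; which sum approximates which integral is the business of the quadrature rule), smoothness-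
or bandwidth-based QTT rank bounds, the continuous (functional) tensor train, matrix product
operators and the quantics Fourier transform [NunezFernandezEtAl2025, §§4.3–4.6, 6.2, 7;
Khoromskij2015, §§1.4–1.5; Lindsey2023].

References: Y. Núñez Fernández, M. K. Ritter, M. Jeannin, J.-W. Li, T. Kloss, T. Louvet,
S. Terasaki, O. Parcollet, J. von Delft, H. Shinaoka, X. Waintal, *Learning tensor networks with
tensor cross interpolation: new algorithms and libraries*, SciPost Phys. 18 (2025) 104,
arXiv:2407.02454 (`NunezFernandezEtAl2025`), §4.1, §4.7, §5.1, §6.1; B. N. Khoromskij, *Tensor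
numerical methods for multidimensional PDEs: theoretical analysis and initial applications*,
ESAIM Proc. Surveys 48 (2015) 1–28 (`Khoromskij2015`), §1.2, §1.3 (Lem. 1.4, Ex. 1.5), §1.5;
G. H. Golub, C. F. Van Loan, *Matrix Computations*, 4th ed., Johns Hopkins University Press 2013
(`GolubVanLoan2013`), §12.5.8.  Both surveys attribute the quantics format and the exact
low-rank decompositions to B. N. Khoromskij, *O(d log N)-quantics approximation of N-d tensors
in high-dimensional numerical modeling*, Constr. Approx. 34 (2011) 257–280, and I. V. Oseledets,
*Approximation of 2^d × 2^d matrices using tensor decomposition*, SIAM J. Matrix Anal. Appl. 31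
(2010) 2130–2145; the explicit monomial-basis (binomial) cores for polynomials are the
construction of I. V. Oseledets, *Constructive representation of functions in low-rank tensor
formats*, Constr. Approx. 37 (2013) 1–18 (`Oseledets2012`), as reported in M. Lindsey,
*Multiscale interpolative construction of quantized tensor trains*, arXiv:2311.12554
(`Lindsey2023`), §1.  The transfer-matrix formulation (`eval_uniform_of_shift`) is this file's
uniform proof of the cited rank statements, not a construction taken from a specific source.

AI-produced formalisation (H21 engines group, seat eng-quad-2, 2026-08-21); no facts, no axioms
beyond Mathlib's, no `sorry`.
-/

open Matrix Finset

namespace Literature.LinearAlgebra.TensorNetworks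

universe u v

/-- A TENSOR TRAIN (matrix product state) with `L` sites, each leg indexed by `σ`, over `K`:
bond dimensions `r 0, r 1, …, r L`, cores `core ℓ a` (an `r ℓ × r (ℓ+1)` matrix for every site
`ℓ < L` and leg value `a`; cores at `ℓ ≥ L` are never used) and boundary vectors `lbdry ∈ K^{r 0}`,
`rbdry ∈ K^{r L}`; its value at a configuration `s` is `lbdry ⬝ (core 0 (s 0) ⋯ core (L-1) (s (L-1))) rbdry`
(`eval`).  The usual convention `r 0 = r L = 1` [GolubVanLoan2013, §12.5.8 (12.5.25);
NunezFernandezEtAl2025, §4.1] is the special case `lbdry = rbdry = 1` (`eval_eq_entry`); boundary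
vectors avoid dependent casts and make the exact constructions below uniform in the site.
[cite: GolubVanLoan2013, §12.5.8] -/
structure TensorTrain (K : Type u) [CommSemiring K] (σ : Type v) (L : ℕ) where
  /-- bond dimensions `r 0, …, r L` (values beyond `L` are irrelevant) -/
  r : ℕ → ℕ
  /-- the core of site `ℓ` at leg value `a`, an `r ℓ × r (ℓ+1)` matrix -/
  core : (ℓ : ℕ) → σ → Matrix (Fin (r ℓ)) (Fin (r (ℓ + 1))) K
  /-- left boundary vector -/
  lbdry : Fin (r 0) → K
  /-- right boundary vector -/
  rbdry : Fin (r L) → K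

namespace TensorTrain

variable {K : Type u} [CommSemiring K] {σ : Type v} {L : ℕ} (T : TensorTrain K σ L)

/-- `leftProd k s = core 0 (s 0) * ⋯ * core (k-1) (s (k-1))`, the ordered product of the first
`k` cores along the configuration `s` (an `r 0 × r k` matrix; `= 1` for `k = 0`).
[cite: GolubVanLoan2013, §12.5.8] -/
def leftProd : (k : ℕ) → (Fin k → σ) → Matrix (Fin (T.r 0)) (Fin (T.r k)) K
  | 0, _ => 1
  | k + 1, s => leftProd k (Fin.init s) * T.core k (s (Fin.last k))

/-- `segProd k m t = core k (t 0) * ⋯ * core (k+m-1) (t (m-1))`, the ordered product of the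
`m` cores of the sites `k, …, k+m-1` (an `r k × r (k+m)` matrix).
[cite: GolubVanLoan2013, §12.5.8] -/
def segProd (k : ℕ) : (m : ℕ) → (Fin m → σ) → Matrix (Fin (T.r k)) (Fin (T.r (k + m))) K
  | 0, _ => (1 : Matrix (Fin (T.r k)) (Fin (T.r k)) K)
  | m + 1, t => segProd k m (Fin.init t) * T.core (k + m) (t (Fin.last m))

/-- The value (entry) of the train at the configuration `s : Fin L → σ`:
`lbdry ⬝ (core 0 (s 0) ⋯ core (L-1) (s (L-1))) rbdry`.
[cite: GolubVanLoan2013, §12.5.8] -/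
def eval (s : Fin L → σ) : K :=
  T.lbdry ⬝ᵥ (T.leftProd L s *ᵥ T.rbdry)

/-- Definitional unfolding: the empty product.  [cite: GolubVanLoan2013, §12.5.8] -/
@[simp] theorem leftProd_zero (s : Fin 0 → σ) : T.leftProd 0 s = 1 := rfl

/-- Definitional unfolding: `M_0^{s_0} ⋯ M_k^{s_k} = (M_0^{s_0} ⋯ M_{k-1}^{s_{k-1}}) M_k^{s_k}`.
[cite: GolubVanLoan2013, §12.5.8] -/
theorem leftProd_succ (k : ℕ) (s : Fin (k + 1) → σ) :
    T.leftProd (k + 1) s = T.leftProd k (Fin.init s) * T.core k (s (Fin.last k)) := rfl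

/-- Appending a site multiplies by its core.  [cite: GolubVanLoan2013, §12.5.8] -/
theorem leftProd_snoc (k : ℕ) (s : Fin k → σ) (a : σ) :
    T.leftProd (k + 1) (Fin.snoc s a) = T.leftProd k s * T.core k a := by
  rw [leftProd_succ, Fin.init_snoc, Fin.snoc_last]

/-- Definitional unfolding: the empty segment product.  [cite: GolubVanLoan2013, §12.5.8] -/
@[simp] theorem segProd_zero (k : ℕ) (t : Fin 0 → σ) : T.segProd k 0 t = 1 := rfl

/-- Definitional unfolding of the segment product.  [cite: GolubVanLoan2013, §12.5.8] -/
theorem segProd_succ (k m : ℕ) (t : Fin (m + 1) → σ) :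
    T.segProd k (m + 1) t = T.segProd k m (Fin.init t) * T.core (k + m) (t (Fin.last m)) := rfl

/-- SPLITTING THE TRAIN AT A BOND: the product of the first `k + m` cores is the product of the
first `k` cores times the product of the next `m`.  [cite: GolubVanLoan2013, §12.5.8] -/
theorem leftProd_split (k : ℕ) : ∀ (m : ℕ) (s : Fin (k + m) → σ),
    T.leftProd (k + m) s =
      T.leftProd k (fun i => s (Fin.castAdd m i)) * T.segProd k m (fun j => s (Fin.natAdd k j))
  | 0, s => by
      show T.leftProd k _ = T.leftProd k _ * 1
      rw [Matrix.mul_one]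
      rfl
  | m + 1, s => by
      show T.leftProd (k + m) (Fin.init s) * T.core (k + m) (s (Fin.last (k + m))) = _
      rw [leftProd_split k m (Fin.init s), segProd_succ, Matrix.mul_assoc]
      rfl

/-- [folklore] Transport of `leftProd` along an equality of lengths (bookkeeping). -/
private theorem leftProd_cast {n n' : ℕ} (h : n = n') (s : Fin n → σ) :
    T.leftProd n' (fun i => s (i.cast h.symm)) =
      fun i j => T.leftProd n s i (j.cast (congrArg T.r h).symm) := by
  subst h
  rfl

/-- With the boundary convention `r 0 = r L = 1`, `lbdry = rbdry = 1`
[GolubVanLoan2013, §12.5.8 (12.5.25); NunezFernandezEtAl2025, §4.1] the value of the train is the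
unique entry of the `1 × 1` matrix `core 0 (s 0) ⋯ core (L-1) (s (L-1))`.
[cite: GolubVanLoan2013, §12.5.8] -/
theorem eval_eq_entry (h0 : T.r 0 = 1) (hL : T.r L = 1) (hl : ∀ i, T.lbdry i = 1)
    (hr : ∀ j, T.rbdry j = 1) (s : Fin L → σ) :
    T.eval s = T.leftProd L s (Fin.cast h0.symm 0) (Fin.cast hL.symm 0) := by
  haveI : Subsingleton (Fin (T.r 0)) := by rw [h0]; infer_instance
  haveI : Subsingleton (Fin (T.r L)) := by rw [hL]; infer_instance
  simp only [eval, dotProduct, mulVec, hl, hr, one_mul, mul_one]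
  rw [Fintype.sum_subsingleton _ (Fin.cast h0.symm 0), Fintype.sum_subsingleton _ (Fin.cast hL.symm 0)]

/-! ### The value is a tensor train: bond sums and unfolding ranks -/

/-- [folklore] The value functional `M ↦ l ⬝ (M r)` commutes with weighted finite sums. -/
private theorem sum_mul_dotProduct_mulVec {ι : Type*} {m n : Type*} [Fintype m] [Fintype n]
    (S : Finset ι) (c : ι → K) (M : ι → Matrix m n K) (l : m → K) (r : n → K) :
    ∑ x ∈ S, c x * (l ⬝ᵥ (M x *ᵥ r)) = l ⬝ᵥ ((∑ x ∈ S, c x • M x) *ᵥ r) := by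
  classical
  induction S using Finset.induction_on with
  | empty => simp
  | insert a S ha ih =>
      rw [Finset.sum_insert ha, Finset.sum_insert ha, ih, Matrix.add_mulVec, dotProduct_add,
        Matrix.smul_mulVec, dotProduct_smul, smul_eq_mul]

/-- ACROSS EVERY BOND THE VALUE IS A SUM OF `r k` PRODUCTS: for `L = k + m`,
`T(s, t) = Σ_{l < r k} (lbdry ⬝ core 0 (s 0) ⋯ core (k-1) (s (k-1)))_l · (core k (t 0) ⋯ rbdry)_l`,
a factor depending only on the first `k` legs times one depending only on the last `m`
[GolubVanLoan2013, §12.5.8 (12.5.25)].  [cite: GolubVanLoan2013, §12.5.8] -/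
theorem eval_append_eq_sum_bond (k m : ℕ) (h : k + m = L) (s : Fin k → σ) (t : Fin m → σ) :
    T.eval (fun i => Fin.append s t (i.cast h.symm)) =
      ∑ l : Fin (T.r k), (T.lbdry ᵥ* T.leftProd k s) l *
        ((Matrix.of fun l j => T.segProd k m t l (j.cast (congrArg T.r h).symm)) *ᵥ T.rbdry) l := by
  rw [eval, leftProd_cast T h (Fin.append s t), leftProd_split]
  simp only [Fin.append_left, Fin.append_right]
  have : (fun i j => (T.leftProd k s * T.segProd k m t) i (Fin.cast (congrArg T.r h).symm j)) =
      T.leftProd k s * Matrix.of fun l j => T.segProd k m t l (Fin.cast (congrArg T.r h).symm j) := by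
    ext i j
    simp only [Matrix.mul_apply, Matrix.of_apply]
  rw [this, ← Matrix.mulVec_mulVec, Matrix.dotProduct_mulVec]
  rfl

/-- UNFOLDING RANKS ARE BOUNDED BY THE BOND DIMENSIONS: the matrix `(s, t) ↦ T(s ⊕ t)` obtained
by grouping the first `k` legs as rows and the last `m = L - k` legs as columns (the `k`-th
unfolding) has rank at most `r k` [Khoromskij2015, §1.5 (the TT format is the set of tensors
with `rank A_[p] ≤ r_p`); GolubVanLoan2013, §12.5.8].  [cite: Khoromskij2015, §1.5] -/
theorem rank_unfolding_le {K : Type u} [Field K] (T : TensorTrain K σ L) [Fintype σ]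
    (k m : ℕ) (h : k + m = L) :
    (Matrix.of fun (s : Fin k → σ) (t : Fin m → σ) =>
        T.eval (fun i => Fin.append s t (i.cast h.symm))).rank ≤ T.r k := by
  classical
  let P : Matrix (Fin k → σ) (Fin (T.r k)) K := Matrix.of fun s l => (T.lbdry ᵥ* T.leftProd k s) l
  let Q : Matrix (Fin (T.r k)) (Fin m → σ) K := Matrix.of fun l t =>
    ((Matrix.of fun l j => T.segProd k m t l (j.cast (congrArg T.r h).symm)) *ᵥ T.rbdry) l
  have hPQ : (Matrix.of fun (s : Fin k → σ) (t : Fin m → σ) =>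
      T.eval (fun i => Fin.append s t (i.cast h.symm))) = P * Q := by
    ext s t
    rw [Matrix.of_apply, eval_append_eq_sum_bond T k m h s t, Matrix.mul_apply]
    rfl
  rw [hPQ]
  calc (P * Q).rank ≤ P.rank := Matrix.rank_mul_le_left P Q
    _ ≤ Fintype.card (Fin (T.r k)) := Matrix.rank_le_card_width P
    _ = T.r k := Fintype.card_fin _

/-! ### TT quadrature: sums against product weights contract site by site -/

/-- `sumProd W k = (Σ_a W 0 a • core 0 a) * ⋯ * (Σ_a W (k-1) a • core (k-1) a)`: the product of
the WEIGHTED SITE SUMS of the first `k` cores.  [cite: NunezFernandezEtAl2025, §5.1] -/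
def sumProd [Fintype σ] (W : ℕ → σ → K) : (k : ℕ) → Matrix (Fin (T.r 0)) (Fin (T.r k)) K
  | 0 => 1
  | k + 1 => sumProd W k * ∑ a, W k a • T.core k a

/-- Definitional unfolding: the empty product of site sums.  [cite: NunezFernandezEtAl2025, §5.1] -/
@[simp] theorem sumProd_zero [Fintype σ] (W : ℕ → σ → K) : T.sumProd W 0 = 1 := rfl

/-- Definitional unfolding: one more weighted site sum.  [cite: NunezFernandezEtAl2025, §5.1] -/
theorem sumProd_succ [Fintype σ] (W : ℕ → σ → K) (k : ℕ) :
    T.sumProd W (k + 1) = T.sumProd W k * ∑ a, W k a • T.core k a := rfl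

/-- SITE-BY-SITE CONTRACTION: summing the product of the first `k` cores against product
weights `Π_ℓ W ℓ (s ℓ)` over all `|σ|^k` configurations gives the product of the `k` weighted
site sums, `Σ_s (Π_ℓ W_ℓ(s_ℓ)) M₀^{s₀} ⋯ M_{k-1}^{s_{k-1}} = (Σ_a W₀(a) M₀^a) ⋯ (Σ_a W_{k-1}(a) M_{k-1}^a)`
— `k · |σ|` core operations instead of `|σ|^k` [NunezFernandezEtAl2025, §5.1 (the factorised sum
`Σ_σ Π_ℓ T_ℓ^{σ_ℓ} P_ℓ⁻¹`); Khoromskij2015, §1.3 (QTT quadrature as a scalar product with a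
rank-1 weight tensor)].  [cite: NunezFernandezEtAl2025, §5.1] -/
theorem sum_prod_smul_leftProd [Fintype σ] (W : ℕ → σ → K) : ∀ k : ℕ,
    ∑ s : Fin k → σ, (∏ ℓ : Fin k, W ℓ (s ℓ)) • T.leftProd k s = T.sumProd W k
  | 0 => by simp
  | k + 1 => by
      have hsnoc : ∀ (a : σ) (s : Fin k → σ),
          (Fin.snocEquiv fun _ : Fin (k + 1) => σ) (a, s) = Fin.snoc s a := fun _ _ => rfl
      rw [← (Fin.snocEquiv fun _ : Fin (k + 1) => σ).sum_comp, Fintype.sum_prod_type, sumProd_succ,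
        ← sum_prod_smul_leftProd W k, Matrix.sum_mul]
      simp only [hsnoc, leftProd_snoc, Fin.prod_univ_castSucc, Fin.snoc_castSucc, Fin.snoc_last,
        Fin.val_castSucc, Fin.val_last]
      rw [Finset.sum_comm]
      refine Finset.sum_congr rfl fun s _ => ?_
      rw [Matrix.mul_sum]
      refine Finset.sum_congr rfl fun a _ => ?_
      rw [Matrix.smul_mul, Matrix.mul_smul, smul_smul]

/-- TT QUADRATURE / FULL CONTRACTION AGAINST A RANK-ONE WEIGHT TENSOR: for a tensor train `T`
with `L` sites and site weights `W ℓ`,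
`Σ_{s} (Π_ℓ W ℓ (s ℓ)) · T(s) = lbdry ⬝ (Σ_a W₀(a) M₀^a) ⋯ (Σ_a W_{L-1}(a) M_{L-1}^a) rbdry`:
an `L`-dimensional sum (e.g. a product quadrature rule applied to a function in TT / TCI form,
`∫ dx f ≈ Σ_σ (Π_ℓ w_{σ_ℓ}) F̃_σ`) costs one pass over the cores [NunezFernandezEtAl2025, §5.1;
Khoromskij2015, §1.3 (`⟨W, F⟩_QTT`) and §1.5 (`⟨X, Y⟩ = ⟨X ⊙ Y, 1⟩`)].
[cite: NunezFernandezEtAl2025, §5.1] -/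
theorem sum_prod_mul_eval [Fintype σ] (W : ℕ → σ → K) :
    ∑ s : Fin L → σ, (∏ ℓ : Fin L, W ℓ (s ℓ)) * T.eval s = T.lbdry ⬝ᵥ (T.sumProd W L *ᵥ T.rbdry) := by
  simp only [eval]
  rw [sum_mul_dotProduct_mulVec, sum_prod_smul_leftProd]

/-- The unweighted case: the plain sum of all `|σ|^L` entries of the train is
`lbdry ⬝ (Σ_a M₀^a) ⋯ (Σ_a M_{L-1}^a) rbdry`.  [cite: NunezFernandezEtAl2025, §5.1] -/
theorem sum_eval [Fintype σ] :
    ∑ s : Fin L → σ, T.eval s = T.lbdry ⬝ᵥ (T.sumProd (fun _ _ => 1) L *ᵥ T.rbdry) := by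
  rw [← sum_prod_mul_eval]
  simp

end TensorTrain


/-! ### The quantics (digit) representation of a grid index -/

section Quantics

variable {b R : ℕ}

/-- THE QUANTICS MAP, most significant digit first: a digit string `σ : Fin R → Fin b` encodes
the grid index `m(σ) = Σ_r σ_r b^{R-1-r} ∈ {0, …, b^R - 1}` (for `b = 2`: `m = (σ₁σ₂⋯σ_R)₂`, the
leading bit `σ 0` resolving the coarsest scale); a bijection `(Fin R → Fin b) ≃ Fin (b^R)`
(Mathlib's little-endian `finFunctionFinEquiv` composed with digit reversal).
[cite: NunezFernandezEtAl2025, §6.1] -/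
def quanticsEquiv (b R : ℕ) : (Fin R → Fin b) ≃ Fin (b ^ R) :=
  (Equiv.arrowCongr Fin.revPerm (Equiv.refl (Fin b))).trans finFunctionFinEquiv

/-- Definitional unfolding: most-significant-first digits are Mathlib's little-endian digits
reversed.  [cite: NunezFernandezEtAl2025, §6.1] -/
theorem quanticsEquiv_apply (σ : Fin R → Fin b) :
    quanticsEquiv b R σ = finFunctionFinEquiv (σ ∘ Fin.rev) := rfl

/-- The encoded index is `m(σ) = Σ_{r < R} σ_r · b^{R-1-r}` (most significant digit first; for
`b = 2` and digits numbered `1, …, R` this is `Σ_r σ_r 2^{R-r}`).  [cite: NunezFernandezEtAl2025, §6.1] -/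
theorem val_quanticsEquiv (σ : Fin R → Fin b) :
    ((quanticsEquiv b R σ : Fin (b ^ R)) : ℕ) = ∑ r : Fin R, (σ r : ℕ) * b ^ (R - (r + 1)) := by
  rw [quanticsEquiv_apply, finFunctionFinEquiv_apply]
  exact Fintype.sum_equiv Fin.revPerm _ _ fun i => by
    simp only [Function.comp_apply, Fin.revPerm_apply, Fin.val_rev]
    congr 2
    omega

/-- Conversely the `r`-th digit of the index `m` is `⌊m / b^{R-1-r}⌋ mod b`.
[cite: NunezFernandezEtAl2025, §6.1] -/
theorem quanticsEquiv_symm_apply_val (m : Fin (b ^ R)) (r : Fin R) :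
    (((quanticsEquiv b R).symm m) r : ℕ) = (m : ℕ) / b ^ (R - (r + 1)) % b := by
  simp [quanticsEquiv, Equiv.arrowCongr, finFunctionFinEquiv_symm_apply_val, Fin.val_rev]

/-- THE GRID POINT: `x(σ) = m(σ) / b^R = Σ_r σ_r b^{-(r+1)} ∈ [0, 1)`, digit `r` resolving the
scale `b^{-(r+1)}` (in any field in which `b ≠ 0`).  [cite: NunezFernandezEtAl2025, §6.1] -/
theorem cast_quanticsEquiv_div_pow {F : Type*} [Field F] (hb : (b : F) ≠ 0) (σ : Fin R → Fin b) :
    ((quanticsEquiv b R σ : ℕ) : F) / (b : F) ^ R =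
      ∑ r : Fin R, ((σ r : ℕ) : F) / (b : F) ^ ((r : ℕ) + 1) := by
  rw [val_quanticsEquiv, Nat.cast_sum, Finset.sum_div]
  refine Finset.sum_congr rfl fun r _ => ?_
  rw [Nat.cast_mul, Nat.cast_pow]
  have hr : R = (R - (r + 1)) + ((r : ℕ) + 1) := by omega
  rw [show (b : F) ^ R = (b : F) ^ ((r : ℕ) + 1) * (b : F) ^ (R - (r + 1)) by
    rw [← pow_add, add_comm, ← hr]]
  rw [mul_div_mul_right _ _ (pow_ne_zero _ hb)]

/-- A sum over the `b^R`-point grid is the sum over all digit strings (the `R`-dimensional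
`b × ⋯ × b` tensor of grid values has the same entries as the grid vector).
[cite: NunezFernandezEtAl2025, §6.1] -/
theorem sum_comp_quanticsEquiv {M : Type*} [AddCommMonoid M] (g : Fin (b ^ R) → M) :
    ∑ σ : Fin R → Fin b, g (quanticsEquiv b R σ) = ∑ m, g m :=
  (quanticsEquiv b R).sum_comp g

variable (b) (N R : ℕ)

/-- INTERLEAVED quantics representation of an `N`-variable function on a `(b^R)^N` grid: the
`R · N` sites are ordered scale-major, site `ℓ(n, r) = n + N·r` carrying digit `r` of variable `n`
(digits of the same scale adjacent) [NunezFernandezEtAl2025, §6.1, `ℓ = n + (r-1)N`]; as a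
bijection from site configurations `Fin (R * N) → Fin b` to grid multi-indices `Fin N → Fin (b^R)`.
[cite: NunezFernandezEtAl2025, §6.1] -/
def interleavedEquiv : (Fin (R * N) → Fin b) ≃ (Fin N → Fin (b ^ R)) :=
  (((Equiv.arrowCongr finProdFinEquiv.symm (Equiv.refl (Fin b))).trans
      (Equiv.curry (Fin R) (Fin N) (Fin b))).trans (Equiv.piComm fun _ _ => Fin b)).trans
    (Equiv.piCongrRight fun _ => quanticsEquiv b R)

/-- SERIAL (variable-major) quantics representation: the `N · R` sites are ordered variable by
variable, site `ℓ(n, r) = r + R·n` carrying digit `r` of variable `n` (all digits of `x₁` first,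
then all digits of `x₂`, …; grouping the `R` digits of each variable into one leg of dimension
`b^R` gives the natural representation `T_{m₁ ⋯ m_N}`).  [cite: NunezFernandezEtAl2025, §6.1] -/
def serialEquiv : (Fin (N * R) → Fin b) ≃ (Fin N → Fin (b ^ R)) :=
  ((Equiv.arrowCongr finProdFinEquiv.symm (Equiv.refl (Fin b))).trans
      (Equiv.curry (Fin N) (Fin R) (Fin b))).trans
    (Equiv.piCongrRight fun _ => quanticsEquiv b R)

/-- FUSED quantics representation: `R` sites of dimension `b^N`, site `r` carrying the fused digit
`σ̃_r = Σ_n b^n σ_{n r}` that packs the `r`-th digits of all `N` variables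
[NunezFernandezEtAl2025, §6.1, `σ̃_r = Σ_n 2^{n-1} σ_{n r}`].  [cite: NunezFernandezEtAl2025, §6.1] -/
def fusedEquiv : (Fin R → Fin (b ^ N)) ≃ (Fin N → Fin (b ^ R)) :=
  ((Equiv.piCongrRight fun _ : Fin R => finFunctionFinEquiv.symm).trans
      (Equiv.piComm fun _ _ => Fin b)).trans
    (Equiv.piCongrRight fun _ => quanticsEquiv b R)

variable {b N R}

/-- Definitional unfolding: variable `n` of the interleaved configuration `τ` has digits
`r ↦ τ (site (r, n))`.  [cite: NunezFernandezEtAl2025, §6.1] -/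
theorem interleavedEquiv_apply (τ : Fin (R * N) → Fin b) (n : Fin N) :
    interleavedEquiv b N R τ n = quanticsEquiv b R fun r => τ (finProdFinEquiv (r, n)) := rfl

/-- In the interleaved ordering digit `r` of variable `n` sits at site `n + N · r`.
[cite: NunezFernandezEtAl2025, §6.1] -/
theorem interleaved_site_val (r : Fin R) (n : Fin N) :
    ((finProdFinEquiv (r, n) : Fin (R * N)) : ℕ) = n + N * r := by
  simp [finProdFinEquiv]

/-- Definitional unfolding: variable `n` of the serial configuration `τ` has digits
`r ↦ τ (site (n, r))`.  [cite: NunezFernandezEtAl2025, §6.1] -/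
theorem serialEquiv_apply (τ : Fin (N * R) → Fin b) (n : Fin N) :
    serialEquiv b N R τ n = quanticsEquiv b R fun r => τ (finProdFinEquiv (n, r)) := rfl

/-- In the serial ordering digit `r` of variable `n` sits at site `r + R · n`.
[cite: NunezFernandezEtAl2025, §6.1] -/
theorem serial_site_val (n : Fin N) (r : Fin R) :
    ((finProdFinEquiv (n, r) : Fin (N * R)) : ℕ) = r + R * n := by
  simp [finProdFinEquiv]

/-- Definitional unfolding: variable `n` of the fused configuration `τ` has digits
`r ↦ (digit n of τ r)`.  [cite: NunezFernandezEtAl2025, §6.1] -/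
theorem fusedEquiv_apply (τ : Fin R → Fin (b ^ N)) (n : Fin N) :
    fusedEquiv b N R τ n = quanticsEquiv b R fun r => finFunctionFinEquiv.symm (τ r) n := rfl

/-- The fused site index is `σ̃_r = Σ_n σ_{n r} · b^n`, where `σ_{n r}` is digit `r` of variable
`n`.  [cite: NunezFernandezEtAl2025, §6.1] -/
theorem fused_site_val (τ : Fin R → Fin (b ^ N)) (r : Fin R) :
    ((τ r : Fin (b ^ N)) : ℕ) =
      ∑ n : Fin N, (((quanticsEquiv b R).symm (fusedEquiv b N R τ n) r : Fin b) : ℕ) * b ^ (n : ℕ) := by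
  have : ∀ n : Fin N, (quanticsEquiv b R).symm (fusedEquiv b N R τ n) r =
      finFunctionFinEquiv.symm (τ r) n := fun n => by
    rw [fusedEquiv_apply, Equiv.symm_apply_apply]
  simp only [this]
  conv_lhs => rw [← finFunctionFinEquiv.apply_symm_apply (τ r)]
  rw [finFunctionFinEquiv_apply]

/-- Summing a function over the `N`-variable grid is summing its quantics tensor over all site
configurations, in any of the three orderings (so a TT quadrature of the quantics tensor,
`sum_prod_mul_eval`, computes the grid sum).  [cite: NunezFernandezEtAl2025, §6.1] -/
theorem sum_comp_interleavedEquiv {M : Type*} [AddCommMonoid M] (g : (Fin N → Fin (b ^ R)) → M) :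
    ∑ τ : Fin (R * N) → Fin b, g (interleavedEquiv b N R τ) = ∑ m, g m :=
  (interleavedEquiv b N R).sum_comp g

/-- [cite: NunezFernandezEtAl2025, §6.1] -/
theorem sum_comp_serialEquiv {M : Type*} [AddCommMonoid M] (g : (Fin N → Fin (b ^ R)) → M) :
    ∑ τ : Fin (N * R) → Fin b, g (serialEquiv b N R τ) = ∑ m, g m :=
  (serialEquiv b N R).sum_comp g

/-- [cite: NunezFernandezEtAl2025, §6.1] -/
theorem sum_comp_fusedEquiv {M : Type*} [AddCommMonoid M] (g : (Fin N → Fin (b ^ R)) → M) :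
    ∑ τ : Fin R → Fin (b ^ N), g (fusedEquiv b N R τ) = ∑ m, g m :=
  (fusedEquiv b N R).sum_comp g

end Quantics

/-! ### Exact low-rank trains from shift-invariant families -/

namespace TensorTrain

variable {K : Type u} [CommSemiring K] {σ : Type v}

/-- The train with all bond dimensions equal to `n` (`r_0 = ⋯ = r_L = n`), cores `G ℓ a` and
boundary vectors `α`, `β`.  [cite: GolubVanLoan2013, §12.5.8] -/
def uniform (L n : ℕ) (G : ℕ → σ → Matrix (Fin n) (Fin n) K) (α β : Fin n → K) :
    TensorTrain K σ L where
  r := fun _ => n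
  core := G
  lbdry := α
  rbdry := β

/-- `chainProd G k s = G 0 (s 0) * ⋯ * G (k-1) (s (k-1))` for square cores.  [folklore] -/
def chainProd {n : ℕ} (G : ℕ → σ → Matrix (Fin n) (Fin n) K) :
    (k : ℕ) → (Fin k → σ) → Matrix (Fin n) (Fin n) K
  | 0, _ => 1
  | k + 1, s => chainProd G k (Fin.init s) * G k (s (Fin.last k))

/-- Definitional unfolding: the partial products of a uniform train.  [cite: GolubVanLoan2013, §12.5.8] -/
theorem leftProd_uniform (L n : ℕ) (G : ℕ → σ → Matrix (Fin n) (Fin n) K) (α β : Fin n → K) :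
    ∀ (k : ℕ) (s : Fin k → σ), (uniform L n G α β).leftProd k s = chainProd G k s
  | 0, _ => rfl
  | k + 1, s => by
      rw [leftProd_succ, chainProd, leftProd_uniform L n G α β k]
      rfl

/-- Definitional unfolding: the value of a uniform train is `(α M_0^{s_0} ⋯ M_{L-1}^{s_{L-1}}) ⬝ β`.
[cite: GolubVanLoan2013, §12.5.8] -/
theorem eval_uniform (L n : ℕ) (G : ℕ → σ → Matrix (Fin n) (Fin n) K) (α β : Fin n → K)
    (s : Fin L → σ) : (uniform L n G α β).eval s = (α ᵥ* chainProd G L s) ⬝ᵥ β := by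
  rw [eval, leftProd_uniform, Matrix.dotProduct_mulVec]
  rfl

/-- TRANSFER-MATRIX MECHANISM behind the explicit low-rank (Q)TT representations: if a family of
`n` functions `u = (u_0, …, u_{n-1})` on an additive monoid is SHIFT-INVARIANT,
`u (x + a) = u x · M(a)` for matrices `M(a)`, then along any sum `x₀ + Σ_ℓ t_ℓ(s_ℓ)` of
site contributions `u (x₀ + Σ_ℓ t_ℓ(s_ℓ)) = u x₀ · M(t₀(s₀)) ⋯ M(t_{L-1}(s_{L-1}))`
(this file's uniform rendering of the rank-1 / rank-2 / rank-(m+1) decompositions of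
exponential, trigonometric and polynomial vectors [Khoromskij2015, §1.2 and §1.3, Lem. 1.4,
Ex. 1.5]).  [cite: Khoromskij2015, §1.3] -/
theorem apply_add_sum_eq_vecMul_chainProd {A : Type*} [AddCommMonoid A] {n : ℕ}
    (u : A → Fin n → K) (M : A → Matrix (Fin n) (Fin n) K) (hu : ∀ x a, u (x + a) = u x ᵥ* M a)
    (t : ℕ → σ → A) (x₀ : A) : ∀ (k : ℕ) (s : Fin k → σ),
    u (x₀ + ∑ ℓ : Fin k, t ℓ (s ℓ)) = u x₀ ᵥ* chainProd (fun ℓ a => M (t ℓ a)) k s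
  | 0, s => by simp [chainProd]
  | k + 1, s => by
      rw [Fin.sum_univ_castSucc, ← add_assoc, hu, chainProd, ← Matrix.vecMul_vecMul]
      simp only [Fin.val_castSucc, Fin.val_last]
      exact congrArg (· ᵥ* M (t k (s (Fin.last k))))
        (apply_add_sum_eq_vecMul_chainProd u M hu t x₀ k (Fin.init s))

/-- Hence a function in the span of a shift-invariant family of `n` functions, `f = u · c`,
sampled on any grid whose points are sums of site contributions, `x(s) = x₀ + Σ_ℓ t_ℓ(s_ℓ)`
(e.g. the quantics grid `x(σ) = x₀ + h Σ_r σ_r b^{R-1-r}`, left points or cell midpoints), IS a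
tensor train with all bond dimensions `n`: cores `M(t_ℓ(a))`, boundary vectors `u(x₀)` and `c`.
[cite: Khoromskij2015, §1.3] -/
theorem eval_uniform_of_shift {A : Type*} [AddCommMonoid A] {n : ℕ}
    (u : A → Fin n → K) (M : A → Matrix (Fin n) (Fin n) K) (hu : ∀ x a, u (x + a) = u x ᵥ* M a)
    (c : Fin n → K) (t : ℕ → σ → A) (x₀ : A) (L : ℕ) (s : Fin L → σ) :
    (uniform L n (fun ℓ a => M (t ℓ a)) (u x₀) c).eval s = u (x₀ + ∑ ℓ : Fin L, t ℓ (s ℓ)) ⬝ᵥ c := by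
  rw [eval_uniform, apply_add_sum_eq_vecMul_chainProd u M hu t x₀ L s]

end TensorTrain

section Instances

variable {K : Type u} [CommSemiring K] {σ : Type v}

/-! #### Exponentials: rank one -/

/-- EXPONENTIAL / GEOMETRIC SEQUENCES HAVE (Q)TT RANK ONE: `z^{Σ_ℓ t_ℓ(s_ℓ)} = Π_ℓ z^{t_ℓ(s_ℓ)}`,
so on the quantics grid `z^{m(σ)} = Π_r z^{σ_r b^{R-1-r}}` factorises over the digits
[Khoromskij2015, Lem. 1.4 (the exponential `N`-vector `{z^{n-1}}`, `N = q^L`, folds to a rank-1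
`q × ⋯ × q` tensor); NunezFernandezEtAl2025, §6.1 (`e^x = e^{σ₁/2} e^{σ₂/4} ⋯ e^{σ_R/2^R}`)].
[cite: Khoromskij2015, Lem. 1.4] -/
theorem pow_sum_eq_prod_pow (z : K) {k : ℕ} (e : Fin k → ℕ) :
    z ^ (∑ ℓ, e ℓ) = ∏ ℓ, z ^ e ℓ :=
  (Finset.prod_pow_eq_pow_sum _ _ _).symm

/-- The same as a bond-dimension-one tensor train: cores the `1 × 1` matrices `(z^{t_ℓ(a)})`.
[cite: Khoromskij2015, Lem. 1.4] -/
theorem TensorTrain.eval_uniform_pow (z : K) (t : ℕ → σ → ℕ) (L : ℕ) (s : Fin L → σ) :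
    (uniform L 1 (fun ℓ a => Matrix.of fun _ _ => z ^ t ℓ a) (fun _ => 1) (fun _ => 1)).eval s =
      z ^ (∑ ℓ : Fin L, t ℓ (s ℓ)) := by
  have hu : ∀ x a : ℕ, (fun _ : Fin 1 => z ^ (x + a)) =
      (fun _ : Fin 1 => z ^ x) ᵥ* (Matrix.of fun _ _ => z ^ a) := fun x a => by
    ext j
    simp [Matrix.vecMul, dotProduct, pow_add]
  have h := eval_uniform_of_shift (fun (x : ℕ) (_ : Fin 1) => z ^ x) (fun a => Matrix.of fun _ _ => z ^ a)
    hu (fun _ => 1) t 0 L s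
  simp only [pow_zero, zero_add] at h
  rw [h]
  simp [dotProduct]

/-- Real exponentials on an affine digit-sum grid: `exp(c (x₀ + Σ_ℓ t_ℓ(s_ℓ))) =
exp(c x₀) Π_ℓ exp(c t_ℓ(s_ℓ))` — rank one [NunezFernandezEtAl2025, §6.1; Khoromskij2015,
Lem. 1.4].  [cite: NunezFernandezEtAl2025, §6.1] -/
theorem real_exp_affine_sum_eq_prod (c x₀ : ℝ) {k : ℕ} (t : Fin k → ℝ) :
    Real.exp (c * (x₀ + ∑ ℓ, t ℓ)) = Real.exp (c * x₀) * ∏ ℓ, Real.exp (c * t ℓ) := by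
  rw [mul_add, Real.exp_add, Finset.mul_sum, Real.exp_sum]

/-! #### Trigonometric functions: rank two -/

/-- The rotation (angle-addition) transfer matrix of `(cos, sin)`.  [cite: Khoromskij2015, Ex. 1.5] -/
noncomputable def rotCore (θ : ℝ) : Matrix (Fin 2) (Fin 2) ℝ :=
  !![Real.cos θ, Real.sin θ; -Real.sin θ, Real.cos θ]

/-- Angle addition as shift invariance: `(cos, sin)(ω(x+a)) = (cos, sin)(ωx) · rotCore (ωa)`.
[cite: Khoromskij2015, Ex. 1.5] -/
theorem cosSin_add_eq_vecMul_rotCore (ω x a : ℝ) :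
    ![Real.cos (ω * (x + a)), Real.sin (ω * (x + a))] =
      ![Real.cos (ω * x), Real.sin (ω * x)] ᵥ* rotCore (ω * a) := by
  ext j
  fin_cases j <;>
    simp [rotCore, Matrix.vecMul, dotProduct, Fin.sum_univ_two, mul_add, Real.cos_add, Real.sin_add] <;>
    ring

/-- TRIGONOMETRIC FUNCTIONS HAVE (Q)TT RANK TWO: on any affine digit-sum grid
`x(s) = x₀ + Σ_ℓ t_ℓ(s_ℓ)`, `c₀ cos(ω x(s)) + c₁ sin(ω x(s))` is the tensor train with the
`2 × 2` rotation cores `rotCore (ω t_ℓ(a))`, left boundary `(cos ωx₀, sin ωx₀)` and right boundary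
`c` [Khoromskij2015, §1.3 (the trigonometric `N`-vector `{sin ω(n-1)}` has TT-rank exactly 2) and
Ex. 1.5; NunezFernandezEtAl2025, §6.1 (sine and cosine: `χ = 2`)].  [cite: Khoromskij2015, Ex. 1.5] -/
theorem TensorTrain.eval_uniform_rotCore (ω x₀ : ℝ) (c : Fin 2 → ℝ) (t : ℕ → σ → ℝ) (L : ℕ) (s : Fin L → σ) :
    (uniform L 2 (fun ℓ a => rotCore (ω * t ℓ a)) ![Real.cos (ω * x₀), Real.sin (ω * x₀)] c).eval s =
      c 0 * Real.cos (ω * (x₀ + ∑ ℓ : Fin L, t ℓ (s ℓ))) +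
        c 1 * Real.sin (ω * (x₀ + ∑ ℓ : Fin L, t ℓ (s ℓ))) := by
  rw [eval_uniform_of_shift (fun x => ![Real.cos (ω * x), Real.sin (ω * x)]) (fun a => rotCore (ω * a))
    (cosSin_add_eq_vecMul_rotCore ω) c t x₀ L s]
  simp [dotProduct, Fin.sum_univ_two, mul_comm]

/-! #### Polynomials of degree `p`: rank `p + 1` -/

/-- The BINOMIAL TRANSFER MATRIX of the monomials `(1, x, …, x^p)`:
`binomShift p a i j = C(j, i) a^{j-i}` for `i ≤ j` (upper triangular).  [cite: Khoromskij2015, §1.2] -/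
def binomShift (p : ℕ) (a : K) : Matrix (Fin (p + 1)) (Fin (p + 1)) K :=
  Matrix.of fun i j => if (i : ℕ) ≤ j then ((j : ℕ).choose i : K) * a ^ ((j : ℕ) - i) else 0

/-- The binomial theorem as shift invariance of the monomials:
`(x + a)^j = Σ_{i ≤ j} x^i C(j, i) a^{j-i}`, i.e. `(x+a)^• = x^• · binomShift p a`.
[cite: Khoromskij2015, §1.2] -/
theorem pow_add_eq_vecMul_binomShift (p : ℕ) (x a : K) :
    (fun j : Fin (p + 1) => (x + a) ^ (j : ℕ)) = (fun i : Fin (p + 1) => x ^ (i : ℕ)) ᵥ* binomShift p a := by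
  ext j
  rw [Matrix.vecMul, dotProduct, add_pow]
  simp only [binomShift, Matrix.of_apply, mul_ite, mul_zero]
  rw [Fin.sum_univ_eq_sum_range (fun i => if i ≤ (j : ℕ) then x ^ i * (((j : ℕ).choose i : K) *
    a ^ ((j : ℕ) - i)) else 0) (p + 1), ← Finset.sum_filter]
  have hf : (Finset.range (p + 1)).filter (fun i => i ≤ (j : ℕ)) = Finset.range ((j : ℕ) + 1) := by
    ext i
    simp only [Finset.mem_filter, Finset.mem_range]
    omega
  rw [hf]
  exact Finset.sum_congr rfl fun i _ => by ring

/-- POLYNOMIALS OF DEGREE `≤ p` HAVE (Q)TT RANK AT MOST `p + 1`: on any affine digit-sum grid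
`x(s) = x₀ + Σ_ℓ t_ℓ(s_ℓ)`, `P(x(s))` is the tensor train with the `(p+1) × (p+1)` binomial cores
`binomShift p (t_ℓ(a))`, left boundary `(x₀^i)_i` and right boundary the coefficient vector of `P`
[Khoromskij2015, §1.2 (polynomials of degree `m` sampled on `N = q^L` points: QTT rank `≤ m + 1`
independently of `N`); the explicit monomial-basis cores are the construction of Oseledets (2013)
(`Oseledets2012`) as reported in [Lindsey2023, §1]].  [cite: Khoromskij2015, §1.2] -/
theorem TensorTrain.eval_uniform_binomShift (P : Polynomial K) (p : ℕ) (hP : P.natDegree ≤ p)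
    (t : ℕ → σ → K) (x₀ : K) (L : ℕ) (s : Fin L → σ) :
    (uniform L (p + 1) (fun ℓ a => binomShift p (t ℓ a)) (fun i => x₀ ^ (i : ℕ))
        (fun i => P.coeff i)).eval s = P.eval (x₀ + ∑ ℓ : Fin L, t ℓ (s ℓ)) := by
  rw [eval_uniform_of_shift (fun (x : K) (i : Fin (p + 1)) => x ^ (i : ℕ)) (binomShift p)
    (pow_add_eq_vecMul_binomShift p) (fun i => P.coeff i) t x₀ L s, dotProduct,
    Polynomial.eval_eq_sum_range' (Nat.lt_succ_of_le hP),
    Fin.sum_univ_eq_sum_range (fun i => (x₀ + ∑ ℓ : Fin L, t ℓ (s ℓ)) ^ i * P.coeff i) (p + 1)]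
  exact Finset.sum_congr rfl fun i _ => mul_comm _ _

/-! #### Kronecker delta: rank one -/

/-- THE KRONECKER DELTA HAS QTT RANK ONE: `δ_{m(σ), m(μ)} = Π_r δ_{σ_r, μ_r}` since the quantics map
is injective [NunezFernandezEtAl2025, §6.1 (the Kronecker delta: `χ = 1`)].
[cite: NunezFernandezEtAl2025, §6.1] -/
theorem quantics_delta_eq_prod {b R : ℕ} (σ μ : Fin R → Fin b) :
    (if quanticsEquiv b R σ = quanticsEquiv b R μ then (1 : K) else 0) =
      ∏ r : Fin R, (if σ r = μ r then (1 : K) else 0) := by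
  rw [Finset.prod_boole]
  by_cases h : σ = μ
  · simp [h]
  · rw [if_neg (fun h' => h ((quanticsEquiv b R).injective h')), if_neg]
    simpa [funext_iff] using h

end Instances


/-! ### Arithmetic in the format: element-wise sums and products of tensor trains -/

namespace TensorTrain

open scoped Kronecker

variable {K : Type u} [CommSemiring K] {σ : Type v} {L : ℕ} (T T' : TensorTrain K σ L)

/-- ELEMENT-WISE SUM of two tensor trains in the format: block-diagonal cores
`M''_ℓ^a = diag(M_ℓ^a, M'_ℓ^a)`, bond dimensions `r ℓ + r' ℓ`, concatenated boundary vectors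
[NunezFernandezEtAl2025, §4.7 (element-wise tensor addition); Khoromskij2015, §1.5].
[cite: NunezFernandezEtAl2025, §4.7] -/
abbrev add : TensorTrain K σ L where
  r := fun ℓ => T.r ℓ + T'.r ℓ
  core := fun ℓ a =>
    Matrix.reindex finSumFinEquiv finSumFinEquiv (Matrix.fromBlocks (T.core ℓ a) 0 0 (T'.core ℓ a))
  lbdry := Sum.elim T.lbdry T'.lbdry ∘ finSumFinEquiv.symm
  rbdry := Sum.elim T.rbdry T'.rbdry ∘ finSumFinEquiv.symm

/-- [folklore] `reindex` is multiplicative (bookkeeping). -/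
private theorem reindex_mul_reindex {l m n o p q : Type*} [Fintype m] [Fintype p]
    (e₁ : l ≃ o) (e₂ : m ≃ p) (e₃ : n ≃ q) (A : Matrix l m K) (B : Matrix m n K) :
    Matrix.reindex e₁ e₂ A * Matrix.reindex e₂ e₃ B = Matrix.reindex e₁ e₃ (A * B) := by
  rw [Matrix.reindex_apply, Matrix.reindex_apply, Matrix.reindex_apply, Matrix.submatrix_mul_equiv]

/-- The partial products of the sum train are the block-diagonal sums of the partial products.
[cite: NunezFernandezEtAl2025, §4.7] -/
theorem leftProd_add : ∀ (k : ℕ) (s : Fin k → σ), (T.add T').leftProd k s =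
    Matrix.reindex finSumFinEquiv finSumFinEquiv
      (Matrix.fromBlocks (T.leftProd k s) 0 0 (T'.leftProd k s))
  | 0, _ => by
      rw [leftProd_zero, leftProd_zero, leftProd_zero, Matrix.fromBlocks_one, Matrix.reindex_apply,
        Matrix.submatrix_one_equiv]
  | k + 1, s => by
      have hc : (T.add T').core k (s (Fin.last k)) = Matrix.reindex finSumFinEquiv finSumFinEquiv
          (Matrix.fromBlocks (T.core k (s (Fin.last k))) 0 0 (T'.core k (s (Fin.last k)))) := rfl
      rw [leftProd_succ, leftProd_add k (Fin.init s), hc, reindex_mul_reindex,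
        Matrix.fromBlocks_multiply, leftProd_succ, leftProd_succ]
      simp

/-- THE SUM TRAIN REPRESENTS THE SUM: `(T + T')(s) = T(s) + T'(s)` — TT ranks are subadditive
[NunezFernandezEtAl2025, §4.7].  [cite: NunezFernandezEtAl2025, §4.7] -/
theorem eval_add (s : Fin L → σ) : (T.add T').eval s = T.eval s + T'.eval s := by
  have hl : (T.add T').lbdry = Sum.elim T.lbdry T'.lbdry ∘ finSumFinEquiv.symm := rfl
  have hr : (T.add T').rbdry = Sum.elim T.rbdry T'.rbdry ∘ finSumFinEquiv.symm := rfl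
  rw [eval, leftProd_add, hl, hr, Matrix.reindex_apply, Matrix.submatrix_mulVec_equiv]
  rw [show (Sum.elim T.rbdry T'.rbdry ∘ ⇑finSumFinEquiv.symm) ∘ ⇑finSumFinEquiv.symm.symm =
      Sum.elim T.rbdry T'.rbdry from by ext x; simp]
  rw [comp_equiv_dotProduct_comp_equiv, Matrix.fromBlocks_mulVec, sumElim_dotProduct_sumElim]
  simp [eval]

/-- ELEMENT-WISE (HADAMARD) PRODUCT of two tensor trains in the format: Kronecker-product cores
`M''_ℓ^a = M_ℓ^a ⊗ M'_ℓ^a`, bond dimensions `r ℓ · r' ℓ` [Khoromskij2015, §1.5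
(`Z = X ⊙ Y : Z^{(k)}_{i_k} = X^{(k)}_{i_k} ⊗ Y^{(k)}_{i_k}`)].  [cite: Khoromskij2015, §1.5] -/
abbrev hadamard : TensorTrain K σ L where
  r := fun ℓ => T.r ℓ * T'.r ℓ
  core := fun ℓ a =>
    Matrix.reindex finProdFinEquiv finProdFinEquiv (T.core ℓ a ⊗ₖ T'.core ℓ a)
  lbdry := fun i => T.lbdry (finProdFinEquiv.symm i).1 * T'.lbdry (finProdFinEquiv.symm i).2
  rbdry := fun i => T.rbdry (finProdFinEquiv.symm i).1 * T'.rbdry (finProdFinEquiv.symm i).2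

/-- The partial products of the Hadamard train are the Kronecker products of the partial products
(the mixed-product property).  [cite: Khoromskij2015, §1.5] -/
theorem leftProd_hadamard : ∀ (k : ℕ) (s : Fin k → σ), (T.hadamard T').leftProd k s =
    Matrix.reindex finProdFinEquiv finProdFinEquiv (T.leftProd k s ⊗ₖ T'.leftProd k s)
  | 0, _ => by
      rw [leftProd_zero, leftProd_zero, leftProd_zero, Matrix.one_kronecker_one, Matrix.reindex_apply,
        Matrix.submatrix_one_equiv]
  | k + 1, s => by
      have hc : (T.hadamard T').core k (s (Fin.last k)) = Matrix.reindex finProdFinEquiv finProdFinEquiv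
          (T.core k (s (Fin.last k)) ⊗ₖ T'.core k (s (Fin.last k))) := rfl
      rw [leftProd_succ, leftProd_hadamard k (Fin.init s), hc, reindex_mul_reindex,
        ← Matrix.mul_kronecker_mul, leftProd_succ, leftProd_succ]

/-- THE HADAMARD TRAIN REPRESENTS THE PRODUCT: `(T ⊙ T')(s) = T(s) · T'(s)` — TT ranks are
submultiplicative; in particular the scalar product of two trains is the full contraction of their
Hadamard product, `⟨X, Y⟩ = ⟨X ⊙ Y, 1⟩` (`sum_eval`) [Khoromskij2015, §1.5].
[cite: Khoromskij2015, §1.5] -/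
theorem eval_hadamard (s : Fin L → σ) : (T.hadamard T').eval s = T.eval s * T'.eval s := by
  have hl : (T.hadamard T').lbdry =
      fun i => T.lbdry (finProdFinEquiv.symm i).1 * T'.lbdry (finProdFinEquiv.symm i).2 := rfl
  have hr : (T.hadamard T').rbdry =
      fun i => T.rbdry (finProdFinEquiv.symm i).1 * T'.rbdry (finProdFinEquiv.symm i).2 := rfl
  rw [eval, leftProd_hadamard, hl, hr]
  simp only [dotProduct, Matrix.mulVec, Matrix.reindex_apply, Matrix.submatrix_apply]
  rw [← finProdFinEquiv.sum_comp, Fintype.sum_prod_type]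
  simp only [Equiv.symm_apply_apply]
  conv_lhs =>
    arg 2; ext i; arg 2; ext i'
    rw [← finProdFinEquiv.sum_comp, Fintype.sum_prod_type]
    simp only [Equiv.symm_apply_apply, Matrix.kroneckerMap_apply]
  rw [eval, eval]
  simp only [dotProduct, Matrix.mulVec, Finset.sum_mul_sum]
  refine Finset.sum_congr rfl fun i _ => Finset.sum_congr rfl fun i' _ => ?_
  simp only [Finset.mul_sum, Finset.sum_mul]
  rw [Finset.sum_comm]
  refine Finset.sum_congr rfl fun j' _ => Finset.sum_congr rfl fun j _ => ?_
  ring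

end TensorTrain


/-! ### Comparison of grid indices digit by digit: the step function has rank two -/

section Step

variable {b R : ℕ}

/-- Appending a least significant digit: `m(σ₀…σ_{R-1} a) = b · m(σ) + a`.
[cite: NunezFernandezEtAl2025, §6.1] -/
theorem val_quanticsEquiv_snoc (σ : Fin R → Fin b) (a : Fin b) :
    ((quanticsEquiv b (R + 1) (Fin.snoc (α := fun _ => Fin b) σ a) : Fin (b ^ (R + 1))) : ℕ) =
      b * (quanticsEquiv b R σ : ℕ) + a := by
  rw [val_quanticsEquiv, val_quanticsEquiv, Fin.sum_univ_castSucc, Finset.mul_sum]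
  simp only [Fin.snoc_castSucc, Fin.snoc_last, Fin.val_castSucc, Fin.val_last]
  congr 1
  · refine Finset.sum_congr rfl fun r _ => ?_
    rw [show R + 1 - ((r : ℕ) + 1) = (R - ((r : ℕ) + 1)) + 1 by omega, pow_succ]
    ring
  · simp

/-- [folklore] Lexicographic comparison of two-digit expansions (bookkeeping). -/
private theorem digit_step_lt_iff {b q q' a a' : ℕ} (ha : a < b) (ha' : a' < b) :
    b * q + a < b * q' + a' ↔ q < q' ∨ (q = q' ∧ a < a') := by
  rcases lt_trichotomy q q' with h | h | h
  · have : b * q + b ≤ b * q' := by rw [← Nat.mul_succ]; exact Nat.mul_le_mul_left b h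
    exact ⟨fun _ => Or.inl h, fun _ => by omega⟩
  · subst h
    exact ⟨fun hh => Or.inr ⟨rfl, by omega⟩, fun hh => by rcases hh with hh | ⟨_, hh⟩ <;> omega⟩
  · have : b * q' + b ≤ b * q := by rw [← Nat.mul_succ]; exact Nat.mul_le_mul_left b h
    exact ⟨fun _ => by omega, fun hh => by rcases hh with hh | ⟨hh, _⟩ <;> omega⟩

/-- [folklore] Uniqueness of two-digit expansions (bookkeeping). -/
private theorem digit_step_eq_iff {b q q' a a' : ℕ} (ha : a < b) (ha' : a' < b) :
    b * q + a = b * q' + a' ↔ q = q' ∧ a = a' := by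
  rcases lt_trichotomy q q' with h | h | h
  · have : b * q + b ≤ b * q' := by rw [← Nat.mul_succ]; exact Nat.mul_le_mul_left b h
    exact ⟨fun _ => by omega, fun hh => by omega⟩
  · subst h
    exact ⟨fun hh => ⟨rfl, by omega⟩, fun hh => by omega⟩
  · have : b * q' + b ≤ b * q := by rw [← Nat.mul_succ]; exact Nat.mul_le_mul_left b h
    exact ⟨fun _ => by omega, fun hh => by omega⟩

variable {K : Type u} [CommSemiring K]

/-- The COMPARISON AUTOMATON core on a pair of digits `(a, a')`: states (`equal so far`,
`already smaller`); `equal → equal` if `a = a'`, `equal → smaller` if `a < a'`,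
`smaller → smaller` always.  [cite: NunezFernandezEtAl2025, §6.1] -/
def stepCore (p : Fin b × Fin b) : Matrix (Fin 2) (Fin 2) K :=
  !![if p.1 = p.2 then 1 else 0, if p.1 < p.2 then 1 else 0; 0, 1]

/-- Reading two digit strings most significant digit first, the automaton's state vector after
`R` digits is `(𝟙[m(σ) = m(μ)], 𝟙[m(σ) < m(μ)])`.  [cite: NunezFernandezEtAl2025, §6.1] -/
theorem vecMul_chainProd_stepCore : ∀ (R : ℕ) (σ μ : Fin R → Fin b),
    ![(1 : K), 0] ᵥ* TensorTrain.chainProd (fun _ (p : Fin b × Fin b) => (stepCore p : Matrix _ _ K)) R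
        (fun r => (σ r, μ r)) =
      ![if quanticsEquiv b R σ = quanticsEquiv b R μ then 1 else 0,
        if (quanticsEquiv b R σ : ℕ) < quanticsEquiv b R μ then 1 else 0]
  | 0, σ, μ => by
      have : σ = μ := Subsingleton.elim σ μ
      subst this
      simp [TensorTrain.chainProd]
  | R + 1, σ, μ => by
      have hσ : σ = Fin.snoc (α := fun _ => Fin b) (Fin.init σ) (σ (Fin.last R)) :=
        (Fin.snoc_init_self σ).symm
      have hμ : μ = Fin.snoc (α := fun _ => Fin b) (Fin.init μ) (μ (Fin.last R)) :=
        (Fin.snoc_init_self μ).symm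
      rw [TensorTrain.chainProd, ← Matrix.vecMul_vecMul]
      have ih := vecMul_chainProd_stepCore R (Fin.init σ) (Fin.init μ)
      rw [show (fun r : Fin R => ((Fin.init σ : Fin R → Fin b) r, (Fin.init μ : Fin R → Fin b) r)) =
        Fin.init fun r : Fin (R + 1) => (σ r, μ r) from rfl] at ih
      rw [ih]
      conv_rhs => rw [hσ, hμ]
      simp only [Fin.ext_iff, val_quanticsEquiv_snoc,
        digit_step_eq_iff (Fin.isLt _) (Fin.isLt _), digit_step_lt_iff (Fin.isLt _) (Fin.isLt _)]
      ext j
      fin_cases j <;> simp [stepCore, Matrix.vecMul, dotProduct, Fin.sum_univ_two, Fin.ext_iff] <;>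
        split_ifs <;> simp_all <;> omega

/-- THE STEP (HEAVISIDE) FUNCTION HAS QTT RANK TWO: in the fused two-variable quantics
representation (leg `r` = the pair of `r`-th digits of `m₁ = m(σ)` and `m₂ = m(μ)`), the tensor
`c₀ 𝟙[m₁ = m₂] + c₁ 𝟙[m₁ < m₂]` — for `c = (1, 1)` the step `𝟙[m₁ ≤ m₂] = θ(m₂ - m₁)`, for
`c = (0, 1)` the strict step — is the tensor train with the `2 × 2` comparison cores `stepCore`,
left boundary `(1, 0)` and right boundary `c` [NunezFernandezEtAl2025, §6.1 (the Heaviside step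
function: `χ = 2`, citing Khoromskij (2011)); the Kronecker delta `𝟙[m₁ = m₂]` alone is
`quantics_delta_eq_prod`, `χ = 1`].  [cite: NunezFernandezEtAl2025, §6.1] -/
theorem TensorTrain.eval_uniform_stepCore (c : Fin 2 → K) (σ μ : Fin R → Fin b) :
    (TensorTrain.uniform R 2 (fun _ (p : Fin b × Fin b) => (stepCore p : Matrix _ _ K)) ![1, 0] c).eval
        (fun r => (σ r, μ r)) =
      c 0 * (if quanticsEquiv b R σ = quanticsEquiv b R μ then 1 else 0) +
        c 1 * (if (quanticsEquiv b R σ : ℕ) < quanticsEquiv b R μ then 1 else 0) := by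
  rw [TensorTrain.eval_uniform, vecMul_chainProd_stepCore]
  simp [dotProduct, Fin.sum_univ_two, mul_comm]

end Step

end Literature.LinearAlgebra.TensorNetworks
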